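import Literature.MathematicalPhysics.QuantumFieldTheory.Balaban1983to89.Node00.Record13SepLiveSelector
import Literature.MathematicalPhysics.QuantumFieldTheory.Balaban1983to89.Node00.Record13SepCoPRInhabitedOfSepCoP
import Literature.MathematicalPhysics.QuantumFieldTheory.Balaban1983to89.Node00.Record13CoPH

/-!
# NODE 00 — THE bg-FREE CORE `Provisos₁₃Core` AT THE STAGE-13 WITNESS OF RECORD `theta13LiveOfRecord F N` IS A THEOREM (hypothesis-free), and so are node00-def-T's
# v1.6 ∕ v1.7 core provisos at node00-def-K0a's cured extension of it and at its history-blind door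

Cell `pub-ymgap`, YM-PLAN Track A (HUMAN RULING D-0062), filed by seat `pub-ymgap-dag-n11-e` (g13; prover, helper lane of K1⁷ `StabilityBAtRecordR13SepCoPH` =
stmt-QuantumFields-20542, count-neutral) as a three-line reading of node00-def-K0a's FILE 12a `Node00/Record13SepLiveSelector` at the member of record — nothing new is
constructed; if the K0a ∕ def-T lanes prefer to host these faces, this file is the place to point at.  [III] = [Balaban1988Convergent], [IV] = [Balaban1989LargeFieldI].

WHY THIS FILE.  Fifteen tree files (this seat's `…N11Diagonal*` ∕ `…N11NoExpansionGeneralStepRePinned*` ∕ `…PostRCoPHOldBranch` ∕ `B14NodeKnitRecord13RCoP`, dag-n07's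
`…N07AtRecord13Co*`, dag-n08's `…N08AtRecord13Co*`) display the hypothesis `(h : (theta13LiveOfRecord F N).Provisos₁₃Core F N)` — the K0-class core conjunct AT THE WITNESS
OF RECORD — as opaque.  It is not: K0a's `theta13LiveOfRecord F N` IS `(theta13OfFamily F N eps0OfRecord₁₃ ζ Rz Zt).liveRepin₁₃ F N` at K0b's residuals of record (`rfl`,
`theta13LiveOfRecord_eq` ∘ `theta13LiveOfFamily_eq`), that family member carries K0b's residuals (`hasResidualsOfRecord_theta13OfFamily`, `rfl`), and FILE 12a's
`Stage13Params.provisos₁₃Core_liveRepin₁₃_of_hasResiduals` gives the core at the live re-pin of EVERY parameter carrying them — OUTRIGHT ((H-U) is K0c's theorem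
`localBgMeasurable`; `zetaUnity`, `zetaAbs`, `rzLaws`, `ztLaws`, `ztLocal` are K0b's; `intPiece` ∕ `measω` ∕ `measChi` ∕ `rstep` are `Record13` §4c's).  FILE 12a states the
all-numerics instance (`provisos₁₃Core_theta13LiveOfNumerics_of_hasResiduals`); this file states the instance AT THE WITNESS OF RECORD and pushes it through K0a's FILE 18
(`Provisos₁₃Core.ofCured`) and def-T's FILE 27 (`Provisos₁₃CoPR.ofHistoryBlind`).  HENCE (all hypothesis-free):
`provisos₁₃Core_theta13LiveOfRecord` · `provisos₁₃CoPR_ofCured_theta13LiveOfRecord` · `provisos₁₃CoPH_door_theta13LiveOfRecord`.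

HONEST FRAMING.  Count-neutral kernel bookkeeping (three one-line applications of accepted K0a ∕ K0c ∕ K0b ∕ def-T theorems); the SEPARATED-RANGE row P11 `bg`
(`Provisos₁₃Sep*`, the K0⁷ antecedent's proviso) is NOT touched — it is node00-def-P11's analysis and stays displayed wherever it is; nothing of Bałaban asserted; NODE 00 ∕ N11
NOT discharged; no K-item closed; counts unmoved (typed 28∕28 · discharged 5∕27).  One finite `𝕋⁴_{L^K}` programme at fixed `ε = L^{−K}`; NOT ℝ⁴, NOT OS, NOT a mass gap,
NOT Clay.
Sources: [III] (2.12) p.256, (2.18) p.257, (2.21) p.258, (3.2)–(3.9) pp.265–266, (3.16) p.268, (3.20)–(3.22) p.269, (3.24)–(3.25) p.270; [IV] (0.3)–(0.4) p.176, p.177 (i)–(ii);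
[Balaban1987RG1] (0.21) p.256.
-/

noncomputable section

namespace Literature.MathematicalPhysics.QuantumFieldTheory.Balaban1983to89.Node00

open T4Continuum

variable (F : T4Family) (N : ℕ) [NeZero N]

/-- **★★ THE bg-FREE CORE `Provisos₁₃Core` HOLDS AT THE STAGE-13 WITNESS OF RECORD — HYPOTHESIS-FREE**: `theta13LiveOfRecord F N` is the ₁₃ live re-pin of the family
member `theta13OfFamily F N eps0OfRecord₁₃ …` at K0b's residuals of record (`rfl`), which carries them (`hasResidualsOfRecord_theta13OfFamily`); K0a's FILE 12a
`Stage13Params.provisos₁₃Core_liveRepin₁₃_of_hasResiduals`. [cite: Balaban1988Convergent, (2.12) p.256, (2.18) p.257, (3.16) p.268, (3.22) p.269; Balaban1989LargeFieldI, (0.3)–(0.4) p.176 (bookkeeping)] -/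
theorem provisos₁₃Core_theta13LiveOfRecord : (theta13LiveOfRecord F N).Provisos₁₃Core F N :=
  Stage13Params.provisos₁₃Core_liveRepin₁₃_of_hasResiduals (θ := theta13OfFamily F N eps0OfRecord₁₃ _ _ _) (hasResidualsOfRecord_theta13OfFamily F N eps0OfRecord₁₃)

/-- **… hence node00-def-T's v1.6 core provisos `Provisos₁₃CoPR` at K0a's CURED extension `Stage13RParams.ofCured (theta13LiveOfRecord F N)` — hypothesis-free** (K0a FILE 18
`Provisos₁₃Core.ofCured`: the run-indexed residual slot `ZrOfRecord₁₃` obeys FILE 17's laws). [cite: Balaban1988Convergent, (2.18) p.257, (3.16)–(3.20) pp.268–269; Balaban1989LargeFieldI, (0.2)–(0.3) p.176 (bookkeeping)] -/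
theorem provisos₁₃CoPR_ofCured_theta13LiveOfRecord : (Stage13RParams.ofCured F N (theta13LiveOfRecord F N)).Provisos₁₃CoPR F N :=
  (provisos₁₃Core_theta13LiveOfRecord F N).ofCured

/-- **… and the v1.7 core provisos `Provisos₁₃CoPH` at the HISTORY-BLIND DOOR `Stage13HParams.ofHistoryBlind (Stage13RParams.ofCured (theta13LiveOfRecord F N))` —
hypothesis-free** (def-T FILE 27 `Provisos₁₃CoPR.ofHistoryBlind`). [cite: Balaban1988Convergent, (2.18) p.257, p.267, (3.16)–(3.20) pp.268–269; Balaban1989LargeFieldI, (0.2)–(0.3) p.176 (bookkeeping)] -/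
theorem provisos₁₃CoPH_door_theta13LiveOfRecord :
    (Stage13HParams.ofHistoryBlind F N (Stage13RParams.ofCured F N (theta13LiveOfRecord F N))).Provisos₁₃CoPH F N :=
  (provisos₁₃CoPR_ofCured_theta13LiveOfRecord F N).ofHistoryBlind

end Literature.MathematicalPhysics.QuantumFieldTheory.Balaban1983to89.Node00

end
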